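import Summits.HodgeConjecture.CorCM.Census.OcticTwistClosing
import Summits.HodgeConjecture.CorCM.Census.OcticTwistClosingMoves
import Summits.HodgeConjecture.CorCM.Census.OcticTwistCoverSlices
import Summits.HodgeConjecture.CorCM.Census.OcticTwistResidual

/-!
# The octic twist `(ℤ/8 × B, (4,0))`, XVI: THE GENERATION THEOREM — `β − 1` rank-four faces generate the octic Hodge lattice modulo
# pairs, integrally, for every finite group `B` of odd order `≥ 3`

COR-CM (cell `pub-hodgecm2`), count-neutral kernel combinatorics by the binder seat b09 (gen 34; lane COINVARIANT-TWIST / OCTIC RECON,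
design step 5 of `HOME/pub-hodgecm2-b09/lean-g33/COINVARIANT-TWIST.md` PART C), the assembly of parts I–XIII (`Census/OcticTwist*.lean`)
used BY NAME: the REDUCTION `exists_reduced₂` (III) under `Covers₂`, the COVERING FAMILY WITH ITS SLICES `exists_cover_family'` (XI),
the count of residual blocks `ten_le_card_residual_blocks` (V), THE OCTIC RESIDUAL THEOREM `residual₂_mem` (IX), the CLOSING MOVES
`closing_moves` (XII) and the nine closing classes `closing_classes` (XIII); quartic equatorial data `QuarticTwistCount.exists_equator`.
Theorems only; no definition, no `decide` table, no certificate, no named fact, no `sorry`.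
HONEST FRAMING: `HC_CM` is NOT proved, here or anywhere in the tree; nothing here is a period or a headline.

**MAIN THEOREM (`hodge₂_le`, family form).**  `|B| = 2m + 1 ≥ 3`, `Q ⊆ B`, `|Q| = m`, `i ≠ j` outside `Q`.  Let `N ≤ hodge₂` be a
MOTION-STABLE submodule containing the octic pairs such that (a) `N` covers (`Covers₂`: through every pair type of potential `≥ 2` a
four-corner relation with smaller corners), (b) every slice `{v | v ⊗ e_y ∈ N}` at a small residual `y` covers in the quartic sense,
(c) `N` contains the mixed squares `(e_{u+kδ_b} − e_u) ⊗ (e_{u′+k′δ_{b′}} − e_{u′})`, and (d) `N` contains the NINE CLOSING FACES of part XIII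
(six mixed `(e_{𝟙_Q} − e_{𝟙_{Q+i}}) ⊗ (e_{Δ+kδ_i} − e_Δ)`, `Δ ∈ {0,1,2}`, `k = ±1`; the column face `(𝟙_Q; (0,i),(1,i)) ⊗ e_0`; the equatorial
faces `(𝟙_Q; (0,i),(0,j)) ⊗ e_c`, `c = 0, 1`).  THEN `hodge₂ ≤ N`.
PROOF: (a) reduces a Hodge vector to the residual pair types (III); (b)–(d) give the nine classes (XIII), hence all lifts `X ⊗ e`, `e ⊗ X`,
`w ⊗ e`, `e ⊗ w` and all D-moves (XII); the residual theorem (IX) absorbs the rest.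
**`exists_faces_generate₂`** (`|B|` odd `≥ 3`): there is a finite family `S` of octic rank-four faces (`IsFace₂`: coset faces and mixed faces)
with `hodge₂ B ≤ pairs₂ B ⊔ spanMot B S` and `|S| + 1 ≤ β(ℤ/8 × B) = #Orb₂` — the covering family of part XI (at most one face per block
of potential `≥ 2`) plus the nine closing faces, against at least ten residual blocks (V).
With the block-parity floor of part XV (`card_orb₂_le_card_add_one`) this becomes the equality `μ(ℤ/8 × B, (4,0)) = β − 1` for `|B|` odd
(`octicTwist_law_eq`, assembled in part XXI `Census/OcticTwistSandwich.lean` next to the any-parity sandwich).  All [folklore].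

## References
* [Pohlmann1968] H. Pohlmann, Algebraic cycles on abelian varieties of complex multiplication type, Ann. of Math. 88 (1968), Thm 1.
* [Milne1999] J. S. Milne, Lefschetz motives and the Tate conjecture, Compositio Math. 117 (1999), Prop. 2.1, p. 54.
-/

namespace Summit.HodgeConjecture.CorCM.Census.OcticTwist

open Finset
open Summit.HodgeConjecture.CorCM.Census.QuarticTwist

variable (B : Type) [AddGroup B] [Fintype B] [DecidableEq B]

/-! ## §1 Monotonicity bookkeeping -/

omit [AddGroup B] in
/-- Quartic covering is inherited by larger submodules. [folklore] -/
theorem covers_mono' {M M' : Submodule ℤ (Ty B → ℤ)} (h : M ≤ M') (hM : Covers B M) : Covers B M' := by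
  intro s hs
  obtain ⟨p, q, hpq, hf, h1, h2, h12⟩ := hM s hs
  exact ⟨p, q, hpq, h hf, h1, h2, h12⟩

omit [Fintype B] [DecidableEq B] in
/-- `spanMot` is monotone in the family. [folklore] -/
theorem spanMot_mono {S S' : Finset (Ty₂ B → ℤ)} (h : S ⊆ S') : spanMot B S ≤ spanMot B S' := by
  refine Submodule.span_mono ?_
  rintro v ⟨e, g, f, hf, rfl⟩
  exact ⟨e, g, f, h hf, rfl⟩

omit [DecidableEq B] in
/-- **`pairs₂ ⊔ spanMot S` is motion-stable.** [folklore] -/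
theorem transl₂_mem_sup {S : Finset (Ty₂ B → ℤ)} {v : Ty₂ B → ℤ} (hv : v ∈ pairs₂ B ⊔ spanMot B S) (e : Bool) (h : ZMod 4 × B) :
    transl₂ B e h v ∈ pairs₂ B ⊔ spanMot B S := by
  obtain ⟨y, hy, z, hz, rfl⟩ := Submodule.mem_sup.mp hv
  rw [transl₂_add]
  exact Submodule.add_mem _ (Submodule.mem_sup_left (transl₂_mem_pairs₂ B hy e h))
    (Submodule.mem_sup_right (transl₂_mem_spanMot B hz e h))

omit [DecidableEq B] in
/-- **The blocks split by potential**: `#{blocks of potential ≥ 2} + #{blocks of potential ≤ 1} = β`. [folklore] -/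
theorem card_blocks_split :
    Fintype.card {ω : Orb₂ B // 2 ≤ potOrb B ω} + Fintype.card {ω : Orb₂ B // potOrb B ω ≤ 1} = Fintype.card (Orb₂ B) := by
  classical
  have h1 : Fintype.card {ω : Orb₂ B // 2 ≤ potOrb B ω} = Fintype.card {ω : Orb₂ B // ¬ potOrb B ω ≤ 1} :=
    Fintype.card_congr (Equiv.subtypeEquivRight fun ω => by omega)
  rw [h1, Fintype.card_subtype_compl, Nat.sub_add_cancel (Fintype.card_subtype_le _)]

/-! ## §2 The generation theorem, family form -/

/-- **THE OCTIC GENERATION THEOREM, family form** (`|B| = 2m + 1`, `m ≥ 1`, `|Q| = m`, `i ≠ j` outside `Q`).  A motion-stable `N ≤ hodge₂`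
containing the octic pairs, covering (`Covers₂`), whose slices at the small residual passive coordinates cover, and which contains the mixed
squares and the nine closing faces of part XIII, is all of `hodge₂`. [folklore] -/
theorem hodge₂_le (hB : Odd (Fintype.card B)) {m : ℕ} (hm : Fintype.card B = 2 * m + 1) (h1 : 1 ≤ m)
    {Q : Finset B} (hQ : Q.card = m) {i j : B} (hi : i ∉ Q) (hj : j ∉ Q) (hji : j ≠ i) {N : Submodule ℤ (Ty₂ B → ℤ)}
    (hNH : N ≤ hodge₂ B) (hmot : ∀ v ∈ N, ∀ (e : Bool) (h : ZMod 4 × B), transl₂ B e h v ∈ N) (hP : pairs₂ B ≤ N)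
    (hcov₂ : Covers₂ B N)
    (hcov : ∀ y : Ty B, IsRes B y → (¬ ∃ (u : ZMod 4) (b : B), y = atom B u b 2) → Covers B (N.comap (emb₀ B y)))
    (hsq : ∀ (u : ZMod 4) (b : B) (k : ZMod 4) (u' : ZMod 4) (b' : B) (k' : ZMod 4), (k = 1 ∨ k = -1) → (k' = 1 ∨ k' = -1) →
      tens B (Pi.single (atom B u b k) 1 - Pi.single (cst B u) 1) (Pi.single (atom B u' b' k') 1 - Pi.single (cst B u') 1) ∈ N)
    (hM : ∀ Δ k : ZMod 4, (Δ = 0 ∨ Δ = 1 ∨ Δ = 2) → (k = 1 ∨ k = -1) →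
      tens B (Pi.single (prof B Q i 0) 1 - Pi.single (prof B Q i 1) 1) (Pi.single (atom B Δ i k) 1 - Pi.single (cst B Δ) 1) ∈ N)
    (hC : tens B (faceVec B (prof B Q i 0) ((0 : ZMod 2), i) ((1 : ZMod 2), i)) (Pi.single (cst B 0) 1) ∈ N)
    (hE : ∀ c : ZMod 4, (c = 0 ∨ c = 1) → tens B (faceVec B (prof B Q i 0) ((0 : ZMod 2), i) ((0 : ZMod 2), j)) (Pi.single (cst B c) 1) ∈ N) :
    hodge₂ B ≤ N := by
  have h3 : 3 ≤ Fintype.card B := by omega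
  -- the nine classes, then the six hypothesis families of the residual theorem
  obtain ⟨hF1, hF2, hF3⟩ := closing_classes B hB hm h1 hQ hi hj hji i hsq hcov hM hC hE
  obtain ⟨hX0, hX1, hW0, hW1, hD0, hD1⟩ := closing_moves B hmot hP hF1 hF2 hF3
  -- reduce and absorb
  intro v hv
  obtain ⟨r, hr, hsupp⟩ := exists_reduced₂ B hcov₂ v
  have hrH : r ∈ hodge₂ B := by
    have e : r = v - (v - r) := by abel
    rw [e]
    exact Submodule.sub_mem _ hv (hNH hr)
  have hrN : r ∈ N := residual₂_mem B h3 hNH hP hX0 hX1 hW0 hW1 hD0 hD1 hrH hsupp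
  have e : v = (v - r) + r := by abel
  rw [e]
  exact Submodule.add_mem _ hr hrN

/-! ## §3 A generating family of `β − 1` octic faces -/

/-- **EXISTENCE OF A GENERATING FAMILY OF AT MOST `β − 1` OCTIC FACES** (`|B|` odd, `≥ 3`): there is a finite family `S` of octic rank-four
faces (coset faces and mixed faces) whose motions generate the octic Hodge lattice modulo the octic pairs, integrally —
`hodge₂ B ≤ pairs₂ B ⊔ spanMot B S` — with `|S| + 1 ≤ β = #Orb₂ B` (the covering family of part XI, at most one face per block of potential
`≥ 2`, plus the nine closing faces of part XIII, against the at least ten residual blocks of part V). [folklore] -/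
theorem exists_faces_generate₂ (hB : Odd (Fintype.card B)) (h3 : 3 ≤ Fintype.card B) :
    ∃ S : Finset (Ty₂ B → ℤ), (∀ f ∈ S, IsFace₂ B f) ∧ hodge₂ B ≤ pairs₂ B ⊔ spanMot B S ∧
      S.card + 1 ≤ Fintype.card (Orb₂ B) := by
  classical
  obtain ⟨m, hm⟩ := hB
  have h1 : 1 ≤ m := by omega
  obtain ⟨Q, i, j, hQ, hi, hj, hji⟩ := exists_equator B hm h1
  obtain ⟨S, hSface, hScard, hcov₂, hsl₀, -, hsq⟩ := exists_cover_family' B h3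
  -- the nine closing faces
  let P0 : Ty B := prof B Q i 0
  let P1 : Ty B := prof B Q i 1
  let mixed : ZMod 4 → ZMod 4 → (Ty₂ B → ℤ) := fun Δ k =>
    tens B (Pi.single P0 1 - Pi.single P1 1) (Pi.single (atom B Δ i k) 1 - Pi.single (cst B Δ) 1)
  let col : Ty₂ B → ℤ := tens B (faceVec B P0 ((0 : ZMod 2), i) ((1 : ZMod 2), i)) (Pi.single (cst B 0) 1)
  let eqf : ZMod 4 → (Ty₂ B → ℤ) := fun c => tens B (faceVec B P0 ((0 : ZMod 2), i) ((0 : ZMod 2), j)) (Pi.single (cst B c) 1)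
  let L : List (Ty₂ B → ℤ) :=
    [mixed 0 1, mixed 0 (-1), mixed 1 1, mixed 1 (-1), mixed 2 1, mixed 2 (-1), col, eqf 0, eqf 1]
  let C : Finset (Ty₂ B → ℤ) := L.toFinset
  have hCcard : C.card ≤ 9 := (List.toFinset_card_le L).trans (by simp [L])
  have hCface : ∀ f ∈ C, IsFace₂ B f := by
    intro f hf
    have hf' : f ∈ L := List.mem_toFinset.mp hf
    simp only [L, List.mem_cons, List.mem_nil_iff, or_false] at hf'
    have hm1 : (1 : ZMod 4) = 1 ∨ (1 : ZMod 4) = -1 := Or.inl rfl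
    have hm2 : (-1 : ZMod 4) = 1 ∨ (-1 : ZMod 4) = -1 := Or.inr rfl
    rcases hf' with rfl | rfl | rfl | rfl | rfl | rfl | rfl | rfl | rfl
    · exact isFace₂_closing_mixed B Q hi 0 i hm1
    · exact isFace₂_closing_mixed B Q hi 0 i hm2
    · exact isFace₂_closing_mixed B Q hi 1 i hm1
    · exact isFace₂_closing_mixed B Q hi 1 i hm2
    · exact isFace₂_closing_mixed B Q hi 2 i hm1
    · exact isFace₂_closing_mixed B Q hi 2 i hm2
    · exact isFace₂_closing_column B Q i _
    · exact isFace₂_closing_square B Q hji _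
    · exact isFace₂_closing_square B Q hji _
  have hCmem : ∀ f ∈ L, f ∈ C := fun f hf => List.mem_toFinset.mpr hf
  -- the family and the submodule
  set S' : Finset (Ty₂ B → ℤ) := S ∪ C with hS'
  have hS'face : ∀ f ∈ S', IsFace₂ B f := by
    intro f hf
    rcases Finset.mem_union.mp hf with hf | hf
    · exact hSface f hf
    · exact hCface f hf
  set N : Submodule ℤ (Ty₂ B → ℤ) := pairs₂ B ⊔ spanMot B S' with hN
  have hNH : N ≤ hodge₂ B := sup_le (pairs₂_le_hodge₂ B) (spanMot_le_hodge₂ B fun f hf => mem_hodge₂_of_isFace₂ B (hS'face f hf))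
  have hmot : ∀ v ∈ N, ∀ (e : Bool) (h : ZMod 4 × B), transl₂ B e h v ∈ N := fun v hv e h => transl₂_mem_sup B hv e h
  have hP : pairs₂ B ≤ N := le_sup_left
  have hMS : spanMot B S ≤ N := (spanMot_mono B Finset.subset_union_left).trans le_sup_right
  have hCN : ∀ f ∈ L, f ∈ N := fun f hf =>
    le_sup_right (b := spanMot B S') (mem_spanMot_of_mem B (Finset.mem_union_right S (hCmem f hf)))
  have hcovN : ∀ y : Ty B, IsRes B y → (¬ ∃ (u : ZMod 4) (b : B), y = atom B u b 2) → Covers B (N.comap (emb₀ B y)) :=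
    fun y hy h2 => covers_mono' B (Submodule.comap_mono hMS) (hsl₀ y hy h2).1
  -- generation
  have hgen : hodge₂ B ≤ N := by
    refine hodge₂_le B ⟨m, hm⟩ hm h1 hQ hi hj hji hNH hmot hP (covers₂_mono B hMS hcov₂) hcovN
      (fun u b k u' b' k' hk hk' => hMS (hsq u b k u' b' k' hk hk')) ?_ ?_ ?_
    · intro Δ k hΔ hk
      rcases hΔ with rfl | rfl | rfl <;> rcases hk with rfl | rfl
      · exact hCN (mixed 0 1) (by simp [L])
      · exact hCN (mixed 0 (-1)) (by simp [L])
      · exact hCN (mixed 1 1) (by simp [L])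
      · exact hCN (mixed 1 (-1)) (by simp [L])
      · exact hCN (mixed 2 1) (by simp [L])
      · exact hCN (mixed 2 (-1)) (by simp [L])
    · exact hCN col (by simp [L])
    · intro c hc
      rcases hc with rfl | rfl
      · exact hCN (eqf 0) (by simp [L])
      · exact hCN (eqf 1) (by simp [L])
  -- count
  refine ⟨S', hS'face, hgen, ?_⟩
  have hsplit := card_blocks_split B
  have hten := ten_le_card_residual_blocks B h3
  have hS'card : S'.card ≤ S.card + C.card := Finset.card_union_le S C
  omega

end Summit.HodgeConjecture.CorCM.Census.OcticTwist
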